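/-
Copyright (c) 2026. All rights reserved.
Released under Apache 2.0 license as described in the file LICENSE.
Authors: abc-iut cell, block C / W6 prover seat abc-iut-w6-d060 (gen 2).
-/
import Literature.IUT.LogVolume.UnitLogBoundaryRamification
import HarnessLib

/-!
# `log_p(𝒪_K^×)` at `e = p − 1`, II: `p`-th roots of unity and the residue polynomial `ā + c̄·ā^p`

Second PROOF-ONLY file (no `def`, no named fact) of the boundary-ramification computation
(`UnitLogBoundaryRamification.lean`: key congruence `log_p(1 + ϖa) ≡ ϖ·(a + c·a^p) (mod 𝔪²)`,
`c = ϖ^{p−1}/p`, sandwich `𝔪² ⊆ log_p(𝒪^×) ⊆ 𝔪`).  Setting: `K` a proper ultrametric normed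
`ℚ_p`-algebra (a finite extension of `ℚ_p`), `p` odd, `absRamificationIdx p K = p − 1`, uniformizer `ϖ`.

* §1 `‖(1 + w)^p − 1‖ ≤ ‖ϖ‖²` for `w ∈ 𝔪` (binomial theorem in `𝒪`; `p ≥ 3`).
* §2 a NON-TRIVIAL `p`-th ROOT OF UNITY `ζ ∈ K` is a principal unit with `log_p ζ = 0` and
  `‖1 − ζ‖ = ‖ϖ‖` EXACTLY (were `ζ ∈ 1 + 𝔪²`, injectivity of `log_p` there would force `ζ = 1`); hence
  `a₁ := (ζ − 1)/ϖ` is a UNIT with `a₁ + c·a₁^p ∈ 𝔪` (`exists_norm_eq_one_norm_add_mul_pow_lt_one`).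
* §3 CONVERSELY a unit `a` with `a + c·a^p ∈ 𝔪` LIFTS to a non-trivial `p`-th root of unity
  (`exists_pow_prime_eq_one_of_norm_add_mul_pow_lt_one`): `log_p(1 + ϖa) ∈ 𝔪² = log_p(1 + 𝔪²)`, so
  `1 + ϖa = ζ·u` with `u ∈ 1 + 𝔪²`, `log_p ζ = 0`, `ζ ∉ 1 + 𝔪²`, and `ζ^p ∈ 1 + 𝔪²` has `log_p = 0`, so
  `ζ^p = 1`.  Contrapositive: if `K` has no non-trivial `p`-th root of unity, `ā ↦ ā + c̄·ā^p` has
  trivial kernel on the residue field.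
* §4 the RESIDUE POLYNOMIAL `x ↦ x + γ·x^p` on a finite field `k` of characteristic `p`: it is additive;
  trivial kernel ⇒ bijective; if `γ ≠ 0` and it vanishes identically then `#k ≤ p`; if `#k = p` and it
  has a non-zero zero then it vanishes identically; and the TRANSFER lemmas `K ↔ k = 𝒪_K/𝔪_K`
  (`γ = c̄`): kernel / surjectivity / vanishing statements at the level of norms in `K`.

References: [cite: NeukirchANT1999, Ch. II Prop. (5.5)–(5.7)] [cite: Koblitz1984, Ch. IV §1–2]
[cite: Washington1997, Lemma 1.4, §5.1].  Classical; `logUnits` = the cell's typing of [IUTchIV]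
Prop. 1.2's `log_p(R^×)` ([claim: Mochizuki2012, status: disputed] for that locution only).
-/

noncomputable section

open Metric Set IsUltrametricDist IsLocalRing
open scoped Pointwise

namespace Literature.IUT.LogVolume

open Literature.NumberTheory.GaloisRepresentations.Ultrametric

namespace BoundaryRamification

variable (p : ℕ) [hp : Fact p.Prime]
variable {K : Type*} [NontriviallyNormedField K] [instK : NormedAlgebra ℚ_[p] K] [IsUltrametricDist K]
  [ProperSpace K]

/-! ## 1. `(1 + 𝔪)^p ⊆ 1 + 𝔪²` -/

section PthPower

open scoped NormedField

variable {ϖ : Kˣ} (hϖ : IsUniformizer ϖ) (he : absRamificationIdx p K = p - 1)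
include hϖ he

/-- **`‖(1 + w)^p − 1‖ ≤ ‖ϖ‖²` for `w ∈ 𝔪`** at `e = p − 1`, `p` odd: in `𝒪`, `(w + 1)^p = w^p + 1 + p·w·R`
(binomial theorem, `exists_add_pow_prime_eq`), and `‖w^p‖ ≤ ‖ϖ‖^p`, `‖p·w·R‖ ≤ ‖ϖ‖^{p−1}·‖ϖ‖`, both
`≤ ‖ϖ‖²` as `p ≥ 3`. [cite: NeukirchANT1999, Ch. II Prop. (5.5)] -/
theorem norm_one_add_pow_prime_sub_one_le (hp2 : p ≠ 2) {w : K} (hw : ‖w‖ ≤ ‖(ϖ : K)‖) :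
    ‖(1 + w) ^ p - 1‖ ≤ ‖(ϖ : K)‖ ^ 2 := by
  set r := ‖(ϖ : K)‖ with hr
  have hr0 : 0 ≤ r := norm_nonneg _
  have hr1 : r < 1 := hϖ.norm_lt_one
  have hp3 : 3 ≤ p := by have := hp.out.two_le; omega
  have hw1 : ‖w‖ ≤ 1 := hw.trans hr1.le
  -- binomial theorem inside the valuation ring `𝒪 = {‖x‖ ≤ 1}`
  let W : Valued.integer K := ⟨w, Valued.integer.mem_iff.mpr hw1⟩
  obtain ⟨R, hR⟩ := exists_add_pow_prime_eq hp.out W 1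
  have hRn : ‖(R : K)‖ ≤ 1 := Valued.integer.norm_le_one R
  have hK : (w + 1) ^ p = w ^ p + 1 + (p : K) * w * R := by
    have h := congrArg (fun z : Valued.integer K => (z : K)) hR
    simpa [W] using h
  have hrew : (1 + w) ^ p - 1 = w ^ p + (p : K) * w * R := by
    rw [add_comm, hK]; ring
  rw [hrew]
  refine (norm_add_le_max _ _).trans (max_le ?_ ?_)
  · rw [norm_pow]
    calc ‖w‖ ^ p ≤ r ^ p := by gcongr
      _ ≤ r ^ 2 := pow_le_pow_of_le_one hr0 hr1.le (by omega)
  · rw [norm_mul, norm_mul, norm_prime_eq_norm_pow_sub_one p hϖ he]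
    calc r ^ (p - 1) * ‖w‖ * ‖(R : K)‖ ≤ r ^ (p - 1) * r * 1 := by gcongr
      _ = r ^ p := by
          rw [mul_one, ← pow_succ, Nat.sub_add_cancel hp.out.one_lt.le]
      _ ≤ r ^ 2 := pow_le_pow_of_le_one hr0 hr1.le (by omega)

end PthPower

/-! ## 2. Non-trivial `p`-th roots of unity at `e = p − 1` -/

section Roots

variable {ϖ : Kˣ} (hϖ : IsUniformizer ϖ) (he : absRamificationIdx p K = p - 1)
include hϖ he

omit [ProperSpace K] hϖ he in
/-- A `p`-th root of unity is a principal unit (`ζ̄^p = 1` forces `ζ̄ = 1` in characteristic `p`; the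
tree's `IsPrincipal.of_pow_prime`). [cite: NeukirchANT1999, Ch. II Prop. (5.7)] -/
theorem isPrincipal_of_pow_prime_eq_one {ζ : K} (hζ : ζ ^ p = 1) : IsPrincipal ζ := by
  have hζn : ‖ζ‖ = 1 := norm_eq_one_of_pow_eq_one' hp.out.pos hζ
  refine IsPrincipal.of_pow_prime (p := p) hζn.le ?_
  rw [hζ]; simp [IsPrincipal]

omit hϖ he in
/-- `log_p ζ = 0` for a `p`-th root of unity, in series form `L(ζ) = 0`.
[cite: NeukirchANT1999, Ch. II Prop. (5.5)] -/
theorem logSeries_eq_zero_of_pow_prime_eq_one {ζ : K} (hζ : ζ ^ p = 1) : logSeries ζ = 0 := by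
  rw [← unitLog_of_isPrincipal p (isPrincipal_of_pow_prime_eq_one p hζ)]
  exact unitLog_eq_zero_of_pow_eq_one p hp.out.pos hζ

/-- **`‖1 − ζ‖ = ‖ϖ‖` exactly** for a NON-TRIVIAL `p`-th root of unity at `e = p − 1`: `ζ ∈ 1 + 𝔪`, and
`ζ ∈ 1 + 𝔪²` is impossible since `log_p` is injective there and `log_p ζ = 0 = log_p 1`.
[cite: NeukirchANT1999, Ch. II Prop. (5.7)] [cite: Washington1997, Lemma 1.4] -/
theorem norm_one_sub_eq_of_pow_prime_eq_one {ζ : K} (hζ : ζ ^ p = 1) (hζ1 : ζ ≠ 1) :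
    ‖1 - ζ‖ = ‖(ϖ : K)‖ := by
  have hP := isPrincipal_of_pow_prime_eq_one p hζ
  have hle : ‖1 - ζ‖ ≤ ‖(ϖ : K)‖ := hϖ.norm_le_of_norm_lt_one _ hP
  refine norm_eq_of_sq_lt_of_le hϖ (lt_of_not_ge fun hsq => hζ1 ?_) hle
  have h1 : (1 : K) ∈ {y : K | ‖1 - y‖ ≤ ‖(ϖ : K)‖ ^ 2} := by
    rw [Set.mem_setOf_eq, sub_self, norm_zero]; positivity
  exact logSeries_injOn_sq p hϖ he hsq h1 (by rw [logSeries_eq_zero_of_pow_prime_eq_one p hζ,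
    logSeries_one])

/-- **A non-trivial `p`-th root of unity yields a UNIT ZERO of the residue polynomial**: with
`a₁ := (ζ − 1)/ϖ` one has `‖a₁‖ = 1`, `1 + ϖ·a₁ = ζ` and `a₁ + c·a₁^p ∈ 𝔪` (`c = ϖ^{p−1}/p`), because
`log_p(1 + ϖa₁) = log_p ζ = 0 ∈ 𝔪²` (key congruence). [cite: Washington1997, §5.1] -/
theorem exists_norm_eq_one_norm_add_mul_pow_lt_one (hp2 : p ≠ 2) {ζ : K} (hζ : ζ ^ p = 1) (hζ1 : ζ ≠ 1) :
    ∃ a : K, ‖a‖ = 1 ∧ 1 + (ϖ : K) * a = ζ ∧ ‖a + (ϖ : K) ^ (p - 1) / p * a ^ p‖ < 1 := by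
  have hϖ0 : (ϖ : K) ≠ 0 := ϖ.ne_zero
  have hn := norm_one_sub_eq_of_pow_prime_eq_one p hϖ he hζ hζ1
  refine ⟨(ζ - 1) / ϖ, ?_, ?_, ?_⟩
  · rw [norm_div, ← norm_neg, neg_sub, hn, div_self (norm_ne_zero_iff.mpr hϖ0)]
  · field_simp; ring
  · refine norm_lt_one_of_norm_logSeries_le_sq p hϖ he hp2 (le_of_eq ?_) ?_
    · rw [norm_div, ← norm_neg, neg_sub, hn, div_self (norm_ne_zero_iff.mpr hϖ0)]
    · rw [mul_div_cancel₀ _ hϖ0, add_sub_cancel, logSeries_eq_zero_of_pow_prime_eq_one p hζ, norm_zero]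
      positivity

/-! ## 3. Lifting a unit zero of the residue polynomial to a non-trivial `p`-th root of unity -/

/-- **LIFTING**: a unit `a` with `a + c·a^p ∈ 𝔪` produces a NON-TRIVIAL `p`-th root of unity in `K`.
Proof: `log_p(1 + ϖa) ∈ 𝔪²` (key congruence) `= log_p(1 + 𝔪²)`, so `1 + ϖa = ζ·u` with `u ∈ 1 + 𝔪²` and
`log_p ζ = 0`; `‖1 − ζ‖ = ‖ϖ‖` so `ζ ≠ 1`; `ζ^p ∈ 1 + 𝔪²` (§1) with `log_p(ζ^p) = p·log_p ζ = 0 = log_p 1`,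
so `ζ^p = 1` by injectivity on `1 + 𝔪²`. [cite: Washington1997, Lemma 1.4, §5.1]
[cite: Koblitz1984, Ch. IV §2] -/
theorem exists_pow_prime_eq_one_of_norm_add_mul_pow_lt_one (hp2 : p ≠ 2) {a : K} (ha : ‖a‖ = 1)
    (hΛ : ‖a + (ϖ : K) ^ (p - 1) / p * a ^ p‖ < 1) : ∃ ζ : K, ζ ^ p = 1 ∧ ζ ≠ 1 := by
  set r := ‖(ϖ : K)‖ with hr
  have hr0 : 0 < r := norm_units_pos ϖ
  have hr1 : r < 1 := hϖ.norm_lt_one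
  set y₀ : K := 1 + (ϖ : K) * a with hy₀
  have hx₀ : ‖(ϖ : K) * a‖ = r := by rw [norm_mul, ha, mul_one]
  have hy₀1 : ‖1 - y₀‖ = r := by rw [hy₀, sub_add_cancel_left, norm_neg, hx₀]
  have hy₀P : IsPrincipal y₀ := by rw [IsPrincipal, hy₀1]; exact hr1
  -- `L(y₀) ∈ 𝔪²`, hence `= L(u₁)` with `u₁ ∈ 1 + 𝔪²`
  have hL := norm_logSeries_le_sq_of_norm_lt_one p hϖ he hp2 ha.le hΛ
  obtain ⟨u₁, hu₁, hLu⟩ := exists_logSeries_eq_of_norm_le_sq p hϖ he hL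
  have hu₁P : IsPrincipal u₁ := lt_of_le_of_lt hu₁ (by nlinarith)
  have hu₁n : ‖u₁‖ = 1 := hu₁P.norm_eq_one
  have hu₁0 : u₁ ≠ 0 := norm_pos_iff.mp (by rw [hu₁n]; exact one_pos)
  set ζ : K := y₀ * u₁⁻¹ with hζ
  have hζP : IsPrincipal ζ := hy₀P.mul hu₁P.inv
  -- `L(ζ) = 0`
  have hLinv : logSeries u₁⁻¹ = -logSeries u₁ := by
    have h := logSeries_mul p hu₁P hu₁P.inv
    rw [mul_inv_cancel₀ hu₁0, logSeries_one] at h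
    linear_combination -h
  have hLζ : logSeries ζ = 0 := by
    rw [hζ, logSeries_mul p hy₀P hu₁P.inv, hLinv, hLu, add_neg_cancel]
  -- `‖1 - ζ‖ = r`, so `ζ ≠ 1`
  have h1ζ : ‖1 - ζ‖ = r := by
    have hrew : 1 - ζ = ((u₁ - 1) + (1 - y₀)) * u₁⁻¹ := by
      rw [hζ]; field_simp; ring
    have hlt : ‖u₁ - 1‖ < ‖1 - y₀‖ := by
      rw [hy₀1, ← norm_neg, neg_sub]
      exact lt_of_le_of_lt hu₁ (by nlinarith)
    rw [hrew, norm_mul, norm_inv, hu₁n, inv_one, mul_one,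
      norm_add_eq_max_of_norm_ne_norm hlt.ne, max_eq_right hlt.le, hy₀1]
  refine ⟨ζ, ?_, fun h => ?_⟩
  · -- `ζ^p ∈ 1 + 𝔪²`, `L(ζ^p) = 0 = L(1)`
    have hζ1 : ‖1 - ζ‖ ≤ r := h1ζ.le
    have hpow : ‖1 - ζ ^ p‖ ≤ r ^ 2 := by
      have := norm_one_add_pow_prime_sub_one_le p hϖ he hp2 (w := -(1 - ζ)) (by rwa [norm_neg])
      have hw : (1 : K) + -(1 - ζ) = ζ := by ring
      rwa [hw, ← norm_neg, neg_sub] at this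
    have hLp : logSeries (ζ ^ p) = logSeries 1 := by
      rw [logSeries_pow p hζP, hLζ, mul_zero, logSeries_one]
    have h1 : (1 : K) ∈ {y : K | ‖1 - y‖ ≤ r ^ 2} := by
      rw [Set.mem_setOf_eq, sub_self, norm_zero]; positivity
    exact logSeries_injOn_sq p hϖ he hpow h1 hLp
  · rw [h, sub_self, norm_zero] at h1ζ
    exact hr0.ne h1ζ

/-- Contrapositive, the form consumed by (W1): **if `K` has no non-trivial `p`-th root of unity then the
residue polynomial `ā ↦ ā + c̄·ā^p` has trivial kernel** — `‖a‖ ≤ 1`, `a + c·a^p ∈ 𝔪 ⇒ a ∈ 𝔪`.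
[cite: Washington1997, §5.1] -/
theorem norm_lt_one_of_norm_add_mul_pow_lt_one (hp2 : p ≠ 2) (hμ : ∀ ζ : K, ζ ^ p = 1 → ζ = 1)
    {a : K} (ha : ‖a‖ ≤ 1) (hΛ : ‖a + (ϖ : K) ^ (p - 1) / p * a ^ p‖ < 1) : ‖a‖ < 1 := by
  by_contra hge
  have ha1 : ‖a‖ = 1 := le_antisymm ha (not_lt.mp hge)
  obtain ⟨ζ, hζ, hζ1⟩ := exists_pow_prime_eq_one_of_norm_add_mul_pow_lt_one p hϖ he hp2 ha1 hΛ
  exact hζ1 (hμ ζ hζ)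

end Roots

/-! ## 4. The residue polynomial `x ↦ x + γ·x^p` on a finite field of characteristic `p` -/

section ResiduePolynomial

variable {k : Type*} [Field k] [Finite k] [CharP k p]

omit [Finite k] in
/-- Additivity: `x ↦ x + γ·x^p` is additive in characteristic `p`. [cite: Washington1997, §5.1] -/
theorem addPoly_add (γ x y : k) :
    (x + y) + γ * (x + y) ^ p = (x + γ * x ^ p) + (y + γ * y ^ p) := by
  rw [add_pow_char x y p]; ring

omit [Finite k] in
/-- `x ↦ x + γ·x^p` respects subtraction. [cite: Washington1997, §5.1] -/
theorem addPoly_sub (γ x y : k) :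
    (x - y) + γ * (x - y) ^ p = (x + γ * x ^ p) - (y + γ * y ^ p) := by
  rw [sub_pow_char x y]; ring

omit [Finite k] in
/-- `𝔽_p`-linearity: `(n·x) + γ·(n·x)^p = n·(x + γ·x^p)` for `n ∈ ℕ` (`n^p = n` in `𝔽_p ⊆ k`).
[cite: Washington1997, §5.1] -/
theorem addPoly_natCast_mul (γ x : k) (n : ℕ) :
    ((n : k) * x) + γ * ((n : k) * x) ^ p = (n : k) * (x + γ * x ^ p) := by
  have hn : ((n : k)) ^ p = n := by
    rw [← map_natCast (ZMod.castHom (dvd_refl p) k) n, ← map_pow, ZMod.pow_card]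
  rw [mul_pow, hn]; ring

omit [Finite k] in
/-- Trivial kernel ⇒ injective (additivity). [cite: Washington1997, §5.1] -/
theorem addPoly_injective_of_ker (γ : k) (hker : ∀ x : k, x + γ * x ^ p = 0 → x = 0) :
    Function.Injective fun x : k => x + γ * x ^ p := by
  intro x y hxy
  have h : (x - y) + γ * (x - y) ^ p = 0 := by
    rw [addPoly_sub p γ x y]; exact sub_eq_zero.mpr hxy
  exact sub_eq_zero.mp (hker _ h)

/-- Trivial kernel ⇒ surjective (a finite set). [cite: Washington1997, §5.1] -/
theorem addPoly_surjective_of_ker (γ : k) (hker : ∀ x : k, x + γ * x ^ p = 0 → x = 0) :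
    Function.Surjective fun x : k => x + γ * x ^ p :=
  Finite.surjective_of_injective (addPoly_injective_of_ker p γ hker)

omit [CharP k p] in
/-- **If `γ ≠ 0` and `x + γ·x^p = 0` for ALL `x ∈ k` then `#k ≤ p`**: every non-zero `x` is a root of
`X^{p−1} + γ⁻¹`, which has at most `p − 1` roots. [cite: Washington1997, §5.1] -/
theorem natCard_le_of_forall_addPoly_eq_zero {γ : k} (hγ : γ ≠ 0) (h : ∀ x : k, x + γ * x ^ p = 0) :
    Nat.card k ≤ p := by
  classical
  have hp1 : 1 ≤ p := hp.out.one_lt.le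
  have hp2 : 2 ≤ p := hp.out.two_le
  haveI := Fintype.ofFinite k
  have hroot : ∀ x : k, x ≠ 0 → x ∈ (Polynomial.nthRoots (p - 1) (-γ⁻¹)).toFinset := by
    intro x hx
    rw [Multiset.mem_toFinset, Polynomial.mem_nthRoots (by omega : 0 < p - 1)]
    have hx' := h x
    have hfac : x * (1 + γ * x ^ (p - 1)) = x + γ * x ^ p := by
      conv_rhs => rw [← Nat.sub_add_cancel hp1, pow_succ]
      ring
    rw [hx'] at hfac
    have h1 : 1 + γ * x ^ (p - 1) = 0 := (mul_eq_zero.mp hfac).resolve_left hx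
    have h2 : γ * x ^ (p - 1) = -1 := eq_neg_of_add_eq_zero_right h1
    field_simp
    linear_combination h2
  have hsub : Finset.univ.erase (0 : k) ⊆ (Polynomial.nthRoots (p - 1) (-γ⁻¹)).toFinset :=
    fun x hx => hroot x (Finset.ne_of_mem_erase hx)
  have h1 : (Finset.univ.erase (0 : k)).card = Fintype.card k - 1 := by
    rw [Finset.card_erase_of_mem (Finset.mem_univ _), Finset.card_univ]
  have h2 : (Polynomial.nthRoots (p - 1) (-γ⁻¹)).toFinset.card ≤ p - 1 :=
    (Multiset.toFinset_card_le _).trans (Polynomial.card_nthRoots _ _)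
  have h3 := Finset.card_le_card hsub
  rw [Nat.card_eq_fintype_card]
  omega

omit [Finite k] in
/-- **If `#k = p` and `x + γ·x^p = 0` has a NON-ZERO solution then it holds for ALL `x`**: the kernel of the
additive map is a non-trivial subgroup of a group of prime order. [cite: Washington1997, §5.1] -/
theorem forall_addPoly_eq_zero_of_natCard_eq (γ : k) (hcard : Nat.card k = p) {x₁ : k} (hx₁ : x₁ ≠ 0)
    (h₁ : x₁ + γ * x₁ ^ p = 0) : ∀ x : k, x + γ * x ^ p = 0 := by
  let φ : k →+ k := AddMonoidHom.mk' (fun x => x + γ * x ^ p) (fun x y => addPoly_add p γ x y)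
  haveI : Fact (Nat.card k).Prime := ⟨by rw [hcard]; exact hp.out⟩
  rcases φ.ker.eq_bot_or_eq_top_of_prime_card with h | h
  · exfalso
    have hmem : x₁ ∈ φ.ker := by rw [AddMonoidHom.mem_ker]; exact h₁
    rw [h, AddSubgroup.mem_bot] at hmem
    exact hx₁ hmem
  · intro x
    have hmem : x ∈ φ.ker := by rw [h]; exact AddSubgroup.mem_top x
    rw [AddMonoidHom.mem_ker] at hmem
    exact hmem

end ResiduePolynomial

/-! ## 5. Transfer `K ↔ k = 𝒪_K/𝔪_K`: the residue polynomial of `a ↦ a + c·a^p`, `c ∈ 𝒪_K` -/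

section Transfer

open scoped NormedField

omit hp instK [ProperSpace K] in
/-- `z̄ = 0 ↔ ‖z‖ < 1` for `z ∈ 𝒪`. [cite: NeukirchANT1999, Ch. II Prop. (3.8)] -/
theorem residue_eq_zero_iff_norm_lt_one (z : Valued.integer K) :
    residue (Valued.integer K) z = 0 ↔ ‖(z : K)‖ < 1 := by
  rw [residue_eq_zero_iff, mem_maximalIdeal_iff_norm_lt_one]; rfl

omit hp instK [ProperSpace K] in
/-- A unit has non-zero residue. [cite: NeukirchANT1999, Ch. II Prop. (3.8)] -/
theorem residue_ne_zero_of_norm_eq_one (z : Valued.integer K) (hz : ‖(z : K)‖ = 1) :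
    residue (Valued.integer K) z ≠ 0 := by
  rw [Ne, residue_eq_zero_iff_norm_lt_one, hz]; exact lt_irrefl _

omit hp instK [ProperSpace K] in
/-- The residue of `a + c·a^p` is the residue polynomial at `ā`. [cite: Washington1997, §5.1] -/
theorem residue_add_mul_pow (C A : Valued.integer K) :
    residue (Valued.integer K) (A + C * A ^ p) =
      residue (Valued.integer K) A + residue (Valued.integer K) C * residue (Valued.integer K) A ^ p := by
  simp only [map_add, map_mul, map_pow]

omit hp instK [ProperSpace K] in
/-- Coercion of `a + c·a^p − b` from `𝒪` to `K`. [cite: Washington1997, §5.1] -/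
theorem coe_add_mul_pow_sub (C A B : Valued.integer K) :
    ((A + C * A ^ p - B : Valued.integer K) : K) = (A : K) + (C : K) * (A : K) ^ p - (B : K) := by
  push_cast; rfl

omit hp instK [ProperSpace K] in
/-- **Kernel transfer `K → k`**: if every `a ∈ 𝒪` with `a + c·a^p ∈ 𝔪` lies in `𝔪`, the residue polynomial
`x ↦ x + c̄·x^p` has trivial kernel. [cite: Washington1997, §5.1] -/
theorem addPoly_ker_trivial_of_norm (C : Valued.integer K)
    (h : ∀ a : K, ‖a‖ ≤ 1 → ‖a + (C : K) * a ^ p‖ < 1 → ‖a‖ < 1) :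
    ∀ x : ResidueField (Valued.integer K),
      x + residue (Valued.integer K) C * x ^ p = 0 → x = 0 := by
  intro x hx
  obtain ⟨A, rfl⟩ := residue_surjective x
  have h1 : residue (Valued.integer K) (A + C * A ^ p - 0) = 0 := by
    rw [sub_zero, residue_add_mul_pow, hx]
  rw [residue_eq_zero_iff_norm_lt_one, coe_add_mul_pow_sub] at h1
  simp only [ZeroMemClass.coe_zero, sub_zero] at h1
  exact (residue_eq_zero_iff_norm_lt_one A).mpr (h A (Valued.integer.norm_le_one A) h1)

omit hp instK [ProperSpace K] in
/-- **Surjectivity transfer `k → K`**: if the residue polynomial is onto, every `b ∈ 𝒪` is `a + c·a^p`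
modulo `𝔪` for some `a ∈ 𝒪`. [cite: Washington1997, §5.1] -/
theorem exists_norm_add_mul_pow_sub_lt_one_of_surjective (C : Valued.integer K)
    (hs : Function.Surjective fun x : ResidueField (Valued.integer K) =>
      x + residue (Valued.integer K) C * x ^ p)
    (b : K) (hb : ‖b‖ ≤ 1) : ∃ a : K, ‖a‖ ≤ 1 ∧ ‖a + (C : K) * a ^ p - b‖ < 1 := by
  let B : Valued.integer K := ⟨b, Valued.integer.mem_iff.mpr hb⟩
  obtain ⟨x, hx⟩ := hs (residue (Valued.integer K) B)
  obtain ⟨A, rfl⟩ := residue_surjective x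
  refine ⟨A, Valued.integer.norm_le_one A, ?_⟩
  have h1 : residue (Valued.integer K) (A + C * A ^ p - B) = 0 := by
    rw [map_sub, residue_add_mul_pow, sub_eq_zero]; exact hx
  rw [residue_eq_zero_iff_norm_lt_one, coe_add_mul_pow_sub] at h1
  exact h1

omit hp instK [ProperSpace K] in
/-- **Surjectivity transfer `K → k`**. [cite: Washington1997, §5.1] -/
theorem addPoly_surjective_of_norm (C : Valued.integer K)
    (hs : ∀ b : K, ‖b‖ ≤ 1 → ∃ a : K, ‖a‖ ≤ 1 ∧ ‖a + (C : K) * a ^ p - b‖ < 1) :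
    Function.Surjective fun x : ResidueField (Valued.integer K) =>
      x + residue (Valued.integer K) C * x ^ p := by
  intro y
  obtain ⟨B, rfl⟩ := residue_surjective y
  obtain ⟨a, ha, hab⟩ := hs B (Valued.integer.norm_le_one B)
  let A : Valued.integer K := ⟨a, Valued.integer.mem_iff.mpr ha⟩
  refine ⟨residue (Valued.integer K) A, ?_⟩
  have h1 : residue (Valued.integer K) (A + C * A ^ p - B) = 0 := by
    rw [residue_eq_zero_iff_norm_lt_one, coe_add_mul_pow_sub]; exact hab
  rw [map_sub, residue_add_mul_pow, sub_eq_zero] at h1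
  exact h1

omit hp instK [ProperSpace K] in
/-- **Vanishing transfer `K → k`**: if `a + c·a^p ∈ 𝔪` for every `a ∈ 𝒪` then the residue polynomial
vanishes identically. [cite: Washington1997, §5.1] -/
theorem forall_addPoly_eq_zero_of_norm (C : Valued.integer K)
    (h0 : ∀ a : K, ‖a‖ ≤ 1 → ‖a + (C : K) * a ^ p‖ < 1) :
    ∀ x : ResidueField (Valued.integer K), x + residue (Valued.integer K) C * x ^ p = 0 := by
  intro x
  obtain ⟨A, rfl⟩ := residue_surjective x
  have h1 : residue (Valued.integer K) (A + C * A ^ p - 0) = 0 := by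
    rw [residue_eq_zero_iff_norm_lt_one, coe_add_mul_pow_sub]
    simp only [ZeroMemClass.coe_zero, sub_zero]
    exact h0 A (Valued.integer.norm_le_one A)
  rw [sub_zero, residue_add_mul_pow] at h1
  exact h1

omit hp instK [ProperSpace K] in
/-- **Vanishing transfer `k → K`**. [cite: Washington1997, §5.1] -/
theorem norm_add_mul_pow_lt_one_of_forall_addPoly_eq_zero (C : Valued.integer K)
    (h0 : ∀ x : ResidueField (Valued.integer K), x + residue (Valued.integer K) C * x ^ p = 0)
    (a : K) (ha : ‖a‖ ≤ 1) : ‖a + (C : K) * a ^ p‖ < 1 := by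
  let A : Valued.integer K := ⟨a, Valued.integer.mem_iff.mpr ha⟩
  have h1 : residue (Valued.integer K) (A + C * A ^ p - 0) = 0 := by
    rw [sub_zero, residue_add_mul_pow]; exact h0 _
  rw [residue_eq_zero_iff_norm_lt_one, coe_add_mul_pow_sub] at h1
  simpa using h1

omit hp instK [ProperSpace K] in
/-- **A unit zero in `K` is a non-zero zero in `k`.** [cite: Washington1997, §5.1] -/
theorem exists_ne_zero_addPoly_eq_zero_of_norm (C : Valued.integer K) {a : K} (ha : ‖a‖ = 1)
    (hΛ : ‖a + (C : K) * a ^ p‖ < 1) :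
    ∃ x : ResidueField (Valued.integer K), x ≠ 0 ∧ x + residue (Valued.integer K) C * x ^ p = 0 := by
  let A : Valued.integer K := ⟨a, Valued.integer.mem_iff.mpr ha.le⟩
  refine ⟨residue (Valued.integer K) A, residue_ne_zero_of_norm_eq_one A ha, ?_⟩
  have h1 : residue (Valued.integer K) (A + C * A ^ p - 0) = 0 := by
    rw [residue_eq_zero_iff_norm_lt_one, coe_add_mul_pow_sub]
    simpa using hΛ
  rw [sub_zero, residue_add_mul_pow] at h1
  exact h1

omit [ProperSpace K] in
/-- **`𝔽_p`-linearity at the level of `K`**: `(n·a) + c·(n·a)^p ≡ n·(a + c·a^p) (mod 𝔪)` for `n ∈ ℕ`,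
`a ∈ 𝒪` (Fermat: `n^p ≡ n`). [cite: Washington1997, §5.1] -/
theorem norm_natCast_mul_addPoly_sub_lt_one (C : Valued.integer K) (n : ℕ) (a : K) (ha : ‖a‖ ≤ 1) :
    ‖((n : K) * a + (C : K) * ((n : K) * a) ^ p) - (n : K) * (a + (C : K) * a ^ p)‖ < 1 := by
  haveI := charP_residueField p K
  let A : Valued.integer K := ⟨a, Valued.integer.mem_iff.mpr ha⟩
  have h1 : residue (Valued.integer K) (((n : Valued.integer K) * A + C * ((n : Valued.integer K) * A) ^ p)
      - (n : Valued.integer K) * (A + C * A ^ p)) = 0 := by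
    simp only [map_sub, map_add, map_mul, map_pow, map_natCast]
    rw [addPoly_natCast_mul p, sub_self]
  rw [residue_eq_zero_iff_norm_lt_one] at h1
  push_cast at h1
  exact h1

end Transfer

end BoundaryRamification

end Literature.IUT.LogVolume

end
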